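import Literature.NumberTheory.EllipticCurves.BurungaleSkinnerTianWan2024.CyclotomicMainStatementRankOneBSDOPEN
import Literature.NumberTheory.EllipticCurves.BurungaleSkinnerTianWan2024.SignedMainStatementRankOneBSDOPEN
import Literature.NumberTheory.EllipticCurves.CyclotomicIwasawaMainTheoremIrreducible
import Literature.NumberTheory.EllipticCurves.BSDHeegnerPoints
import Literature.NumberTheory.EllipticCurves.BSDSelmer
import Literature.NumberTheory.EllipticCurves.PAdicLFunctionProofs
import Literature.NumberTheory.EllipticCurves.ModularFormsGamma0Genus
import HarnessLib

/-!
# Burungale–Skinner–Tian–Wan (arXiv:2409.01350v2, PREPRINT), §12.1.1 Prop. 12.1 "A cyclotomic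
# criterion" for the `p`-converse over an imaginary quadratic field, for an elliptic curve:
# "the RATIONAL lower bound for the Selmer group predicted by Kato's main conj. for `E` and for
# `E ⊗ χ_L` + (inj) ⟹ (`corank 1 ⟹ analytic rank 1` over `L`)" — explicitly labelled OPEN binders
# (claim-tagged; NEVER facts), ordinary and supersingular branches, with the one-sided rational
# main-conj. hypotheses spelled as predicates WITH BODY in the tree's cyclotomic currencies

Written by the typer seat `bsd-littype-01` (gen 4) of the cross-ladder literature-typing layer
(D-0088(4); cell `run/shared/lean/pub/bsd-littype/`). D-0064: one file for §12.1.1 of the source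
(§12.1.2 Thm. 12.3 / Cor. 12.5 are gen 0's `ApplicationsPartIIOPEN.lean`; §12.2 is gen 2's
`HeegnerMainStatementOPEN.lean`). HONEST FRAMING: UNREFEREED preprint ⇒ explicitly labelled OPEN
hypotheses only (`def … : Prop`, `[claim: …, status: under-review]`), NEVER theorems, NEVER
`[cite:]`-facts; nothing asserted about any curve; nothing booked; no `_holds`. TWO predicates WITH
BODY (`CharIdealLePadicLFunctionRat W p`, `SignedCharIdealLePadicLFunctionRat W p ε`: the ONE-SIDED,
RATIONAL halves "`ξ(X) ⊆ (𝓛_p)` in `Λ ⊗ ℚ_p`" of the cyclotomic statements 9.3 (b) / 9.4 (b) of the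
source — definitions, asserting nothing, byte-parallel to the two-sided predicates
`CharIdealEqPadicLFunctionNeron` (gen 2) and `SignedCharIdealEqPadicLFunctionNeron` (gen 3) of the
sibling files), TWO OPEN binders (Prop. 12.1, ordinary / supersingular branch), and bookkeeping
theorems PROVED in this file: the two-sided predicates imply the one-sided ones; the tree's REFEREED
Burungale–Castella–Skinner 2025 Thm. 1.1.2 (a) (`burungale_castella_skinner_charIdeal_eq_padicLFunction`,
Mazur's main conj. in `Λ ⊗ ℚ_p` at `p ≥ 5` good ordinary under (irr_ℚ)) supplies the ordinary
predicate; hence, GRANTED the Prop. 12.1 binder, a `p`-converse over `L` at `p ≥ 5` good ordinary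
under (irr_ℚ) for `E` and `E^{(d_L)}` and (inj) — no (ram), no (sur), no Heegner-point main conj.
(`analyticRankEK_eq_one_of_prop121_ordinary_OPEN_of_bcs`).

## Printed statement (arXiv:2409.01350v2, p. 95; litref page file `…/bstw24-v2-pages.json` p0095;
## label `p-converse-prop`, tex l.8089–8110; proof pp. 95–96)

"**Proposition 12.1.** Let `g ∈ S₂(Γ₀(N))` be an elliptic newform. Let `p ∤ 2N` be a prime, `λ` a
prime of the Hecke field `F` of `g` above `p` and `V` the associated `p`-adic Galois representation.
Suppose that either `λ ∤ a_p(g)` or `a_p(g) = 0`. Let `L` be an imaginary quadratic field satisfying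
(2.15), (9.9) and (Heeg). Suppose also the divisibility
`ξ(H¹(ℤ[1/p], T ⊗_{ℤ_p} Λ)/Λ_{𝒪_λ}·𝐳_γ(h)) ∣ ξ(X_st(h))` in `Λ_{L,𝒪_λ} ⊗_{ℤ_p} ℚ_p` for
`h ∈ {g, g ⊗ χ_L}` (cf. Conj[.] 9.6 (b)). If
(inj) The localisation `H¹_f(L, V) → ∏_{w∣p} H¹_f(L_w, V)` is an injection,
then `dim_{F_λ} H¹_f(L, V) = 1 ⟹ ord_{s=1} L(s, g_{/L}) = 1`."
Proof (p. 95–96, "We present the ordinary case"): (inj) + dimension one make `Sel_Gr(g/L)` and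
`Sel_{st,ord}(g/L)` finite [Sk', Lem. 2.3.2]; "the lower bound for Selmer group predicted by the
cyclotomic main Conj[.] 9.8 holds by our hypotheses and Lemma 9.17", so (exv) gives
`φ_{𝟙_L}(𝒵(g/L)^cyc) ≠ 0`, (nv) holds, Prop. 9.18 gives the cyclotomic Greenberg main conj. 9.12,
whence `φ_{𝟙_L}(𝓛_p^{Gr,cyc}(g/L)) ≠ 0`, the Heegner point `y_L` is non-torsion by the `p`-adic
Waldspurger formula (Prop. 5.28), and Gross–Zagier concludes. Remark 12.2 (p. 96): "For non-ordinary
prime `p ∤ N`, the `p`-converse is also a consequence of lower bound for the strict Selmer group as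
predicted by Kato's main conj[.] (cf. [BKO2])." (The c-word is elided in quotations, as in the
sibling files.) Hypothesis labels: (2.15) = (ord) `p = v v̄` splits in `L`; (9.9) = (coprime) `(D_L, N) = 1`; (Heeg)
every prime dividing `N` splits in `L`; statement 9.6 (b) (label `Kato`, p. 80): "`ξ(H¹(ℤ[1/p], T ⊗
Λ)/Λ_{𝒪_λ}·𝐳_γ(g)) = ξ(X_st(g))` in `Λ_{𝒪_λ} ⊗ ℚ_p`"; Lemma 9.16 (label `KatoEq`, p. 82): "a
one-sided divisibility in [statement 9.3 (ordinary) / 9.4 (supersingular, Kobayashi)] implies the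
analogous divisibility in [statement 9.6] and conversely".

## Transcription (E-instances `A_g = E`, `F = ℚ`, `λ = p`, `𝒪_λ = ℤ_p`)

* The printed one-sided hypothesis is the HALF of Kato's statement 9.6 (b) which bounds the strict
  Selmer group from BELOW ("the lower bound for Selmer group", proof, p. 96). By the four-term
  Poitou–Tate sequence `0 → 𝐇¹/Λ𝐳 → Λ/(𝓛_p) → X → X_st → 0` behind Lemma 9.16 (Kato, Astérisque 295,
  §17.13 with Thm. 12.4/12.5; Kobayashi 2003 Thm. 7.4 for `a_p = 0` and each sign), in which
  `ξ(𝐇¹/Λ𝐳)·ξ(X) = (𝓛_p)·ξ(X_st)` with `ξ(𝐇¹/Λ𝐳) ≠ 0`, the half "`ξ(𝐇¹/Λ𝐳) ∣ ξ(X_st)` in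
  `Λ ⊗ ℚ_p`" is the half "`(𝓛_p) ∣ ξ(X)` in `Λ ⊗ ℚ_p`", i.e. `pⁿ·ξ(X) ∈ 𝓛_p·Λ` for some `n`, of
  statement 9.3 (b) (ordinary, `𝓛_p = 𝓛_{α,ω,γ}(g)`) resp. 9.4 (b) (supersingular, `𝓛_p = 𝓛^∘_γ(g)`,
  `X = X_∘`, either sign `∘`) — Lemma 9.16 (i)/(ii) as printed. This is what the two predicates spell,
  in the currencies of the sibling files: `W.SelmerDualData κ γ` / `padicLFunction f (unitRoot W p)`
  (Mazur–Swinnerton-Dyer, `Ω⁺_f`-normalised, then `ϖ·` with `ϖ·Ω_E = Ω⁺_f`: Néron normalisation —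
  immaterial rationally, kept for byte-parallelism with `CharIdealEqPadicLFunctionNeron`) and
  `Kobayashi2003.SignedSelmerDualData W κ γ ε` / `Kobayashi2003.IsSignedPAdicLFunction f p ε L`. The
  `Λ`-torsion clause (a) of 9.3/9.4 is carried INSIDE the predicates (an extra hypothesis of the
  binder, so the binder is WEAKER than print, never stronger; for `E` it is Kato's / Kobayashi's
  theorem anyway, tree facts `kato_divisibility`, `Kobayashi2003.thm12_…`).
* Supersingular branch: the hypothesis is asked for BOTH signs `ε` (READING FLAG
  `BSTW-121-ss-bothsigns`: print's sign-free statement 9.6 (b)-half is equivalent to the 9.4 (b)-half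
  for EACH sign by Lemma 9.16 (ii); asking both is weaker, never stronger) — as in gen 3's
  `prop1111_…_supersingular_OPEN` (flag `BSTW-1111-ss-bothsigns`).
* `dim_{ℚ_p} H¹_f(L, V_pE) = 1` ↦ `(W.baseChange K).selmerCorank p = 1` (the `ℤ_p`-corank of
  `Sel_{p^∞}(E/L)`: `Sel_{p^∞}(E/L)_div ≅ H¹_f(L, V)/(image of H¹(L, T)) ≅ (ℚ_p/ℤ_p)^{dim H¹_f(L,V)}`).
* (inj) ↦ the JOINT strict Selmer group at the primes above `p`,
  `Sel_{p^∞}(E/L) ∩ ⋂_{w ∣ p} ker(H¹(L, E[p^∞]) → H¹(L_w, E(L̄_w)[p^∞]))`, is FINITE (its `ℤ_p`-corank is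
  `dim ker(H¹_f(L,V) → ∏_{w∣p} H¹_f(L_w,V))`: a line `ℚ_p·c ⊆ H¹_f(L,V)` with `loc_w c ≠ 0` meets the
  kernel of `E(L_w) ⊗ ℚ_p → E(L_w) ⊗ ℚ_p/ℤ_p` in a lattice, so contributes a finite group) — spelled with
  the tree's `selmerLocalKerPrimaryTorsion` (`BSDSelmer.lean`, the `hloc`/`hres` vocabulary of
  `StrictSelmerRankOne.lean` and `finite_selmerAcBase_of_resCorankOne_imaginaryQuadratic`), jointly over
  `{w : (p : 𝓞 L) ∈ w}` (FAITHFUL; the per-place finiteness used elsewhere in the tree is stronger).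
* `ord_{s=1} L(s, g_{/L}) = 1` ↦ `analyticRankEK W K = 1` (`BSDHeegnerPoints.lean`: the order at `s = 1`
  of `L(E,s)·L(E^{(d_L)},s) = L(E/L,s)`), exactly as in the tree's Thm. 1.10 binder
  `burungaleSkinnerTianWan_analyticRankEK_eq_one_of_selmerCorank_eq_one` (`BSDSelmerPConverse.lean`).
* `p ∤ 2N` ↦ `p ≠ 2`, good reduction at `p`; "`λ ∤ a_p` or `a_p = 0`" ↦ `¬ p ∣ a_p` (ordinary binder)
  resp. `W.frobeniusTrace p = 0` (supersingular binder); (ord) ↦ `#primesOver p = 2`; (coprime) ↦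
  `IsCoprime d_L N_E`; (Heeg) ↦ `SatisfiesHeegnerHypothesis N_E L`; `g ⊗ χ_L` ↦ a globally minimal
  model `W'` of `E^{(d_L)}` (`C • W' = W.quadraticTwist d_L`), as in the sibling files.

WEAKER-OR-EQUAL to print in every binder; never stronger. WHAT IS NOT HERE: the newform /
`GL₂`-type generality (`[F:ℚ] > 1`); Remark 12.2's [BKO2] road; Thm. 12.3 / Cor. 12.5 (gen 0);
§12.2 (gen 2); any two-variable object of the proof ((exv), (nv), Prop. 9.18, Prop. 5.28 — no tree
carriers for the two-variable zeta element, see the seat's SHEET-g3 §CARRIER CENSUS).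

CONSUMERS: the `p`-converse lanes (`BSDSelmerPConverse*.lean`, littype-06's `SelmerCorankPConverse`
leaf, CornerF / Goldfeld proportions): Prop. 12.1 is the criterion behind Prop. 12.10, Thm. 12.3 and
Thm. 12.11 = 1.10, with the WEAKEST Iwasawa-theoretic input of the paper's `p`-converse roads — a
RATIONAL ONE-SIDED cyclotomic divisibility, in print far beyond (ram)/(sur) (BCS25 Thm. 1.1.2 (a) under
(irr_ℚ) alone, bridged below; CGS25 Thm. A at Eisenstein `p` via `charIdealEqPadicLFunctionNeron_of_thmA`).

## References
* [BurungaleSkinnerTianWan2024] arXiv:2409.01350v2: Prop. 12.1 (p. 95; label p-converse-prop, tex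
  l.8089–8110; proof pp. 95–96, l.8111–8140), Remark 12.2 (p. 96, l.8141–8143), statements 9.3/9.4/9.6
  (pp. 79–80; labels KatopL/KatopLss/Kato), Lemma 9.16 (p. 82; KatoEq, l.7009), Lemma 9.17 (p. 82; Eq',
  l.7021), (2.15) (ord), (9.9) (coprime), (Heeg).
* [BurungaleCastellaSkinner2025] IMRN 2025 = arXiv:2405.00270v2, Thm. 1.1.2 (a) — the tree fact
  `burungale_castella_skinner_charIdeal_eq_padicLFunction` (REFEREED), bridged here.
* [Kato2004Asterisque] §17.13, Thm. 12.4/12.5/17.4; [Kobayashi2003] Thm. 1.3/4.1/7.4 — the currencies.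
* [Skinner2020] Lemma 2.3.2 — the (inj)/(res) vocabulary (`StrictSelmerRankOne.lean`).
-/

noncomputable section

open scoped Classical MatrixGroups ModularForm

open CongruenceSubgroup WeierstrassCurve NumberField IsDedekindDomain
  Literature.NumberTheory.EllipticCurves Literature.NumberTheory.EllipticCurves.ModularForms
  Literature.NumberTheory.EllipticCurves.Rank1Residual

universe u

namespace Literature.NumberTheory.EllipticCurves.BurungaleSkinnerTianWan2024

open Literature.NumberTheory.EllipticCurves.Kobayashi2003

/-! ### The one-sided rational cyclotomic predicates (definitions with body; nothing asserted) -/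

/-- **The ONE-SIDED RATIONAL half "`ξ(X(E/ℚ_∞)) ⊆ (𝓛_p(E))` in `Λ ⊗ ℚ_p`" of the ordinary
cyclotomic statement 9.3 (b) for the pair `(E, p)`** — a PREDICATE on `(W, p)` (definition with body;
nothing asserted, no universal closure stated): for the cyclotomic `ℤ_p`-extension `κ` with a
topological generator `γ` matching the cyclotomic variable, the newform `f` of `E` at level `N_E`, the
rational `ϖ` with `ϖ · Ω_E = Ω⁺_f` and every Pontryagin-dual datum `D` of `Sel_{p^∞}(E/ℚ_∞)`: `X = D.X`
is `Λ`-torsion and `char_Λ X = (g)` with `ι(pⁿ · g) = ι(c) · ϖ · L_p(f, α)` in `ℚ_p⟦T⟧` for some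
`n ≥ 0` and some `c ∈ Λ` — "`pⁿ ξ(X) ∈ 𝓛_p · Λ`", i.e. `𝓛_p ∣ ξ(X)` in `Λ ⊗ ℚ_p`: the LOWER BOUND for
the Selmer group predicted by the main conj. (the half NOT given by Kato's Euler-system argument,
whose half is the tree's `kato_divisibility` / `Wuthrich2014.charIdeal_dvd_padicLFunction`). By the
four-term sequence behind Lemma 9.16 (i) this is the printed hypothesis of Prop. 12.1, "`ξ(H¹(ℤ[1/p],
T ⊗ Λ)/Λ·𝐳_γ(g)) ∣ ξ(X_st(g))` in `Λ ⊗ ℚ_p`" (module docstring). Same quantifier prefix as the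
two-sided `CharIdealEqPadicLFunctionNeron W p` of the sibling file, which implies it
(`charIdealLePadicLFunctionRat_of_charIdealEq`); the period `ϖ ∈ ℚˣ` is immaterial rationally.
[cite: BurungaleSkinnerTianWan2024, statement 9.3 (b) (p. 79; label KatopL) with Lemma 9.16 (i) (p. 82) and the hypothesis display of Prop. 12.1 (p. 95) (shape only; nothing asserted)]
[cite: Kato2004Asterisque, §17.13 with Thm. 12.5 (shape only)] -/
def CharIdealLePadicLFunctionRat (W : WeierstrassCurve ℚ) [W.IsElliptic] [W.IsGloballyMinimal]
    (p : ℕ) [Fact p.Prime] : Prop :=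
  ∀ (κ : ZpExtension ℚ p) (γ : Field.absoluteGaloisGroup ℚ),
      κ.IsCyclotomic → κ.IsTopGenerator γ → IsCyclotomicVariable p γ →
    ∀ [NeZero (W.conductorNorm ℤ)] (f : CuspForm (Gamma0 (W.conductorNorm ℤ)) 2),
      IsNewformOf W f → ∀ (ϖ : ℚ), (ϖ : ℝ) * W.realPeriodRat = plusPeriod f →
    ∀ (D : W.SelmerDualData κ γ), D.IsTorsion ∧
      ∃ (g c : IwasawaAlgebra p) (n : ℕ), D.charIdeal = Ideal.span {g} ∧
        iwasawaToPowerSeries p ((p : IwasawaAlgebra p) ^ n * g) =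
          iwasawaToPowerSeries p c *
            (PowerSeries.C (ϖ : ℚ_[p]) * padicLFunction f (unitRoot W p : ℚ_[p]))

/-- **The ONE-SIDED RATIONAL half "`ξ(X_∘(E/ℚ_∞)) ⊆ (𝓛_p^∘(E))` in `Λ ⊗ ℚ_p`" of Kobayashi's signed
cyclotomic statement 9.4 (b) for the triple `(E, p, ε)`** — a PREDICATE on `(W, p, ε)` (definition
with body; nothing asserted): for the cyclotomic `κ`, `γ` matching the cyclotomic variable, the
newform `f` of `E` at level `N_E`, the rational `ϖ` with `ϖ · Ω_E = Ω⁺_f`, every `L ∈ Λ` which is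
Pollack's `L_p^ε(E, X)` in Kobayashi's labelling (`Kobayashi2003.IsSignedPAdicLFunction f p ε L`) and
every Pontryagin-dual datum `D` of `Sel^ε(E/ℚ_∞)` (`Kobayashi2003.SignedSelmerDualData W κ γ ε`):
`X^ε = D.X` is `Λ`-torsion and `char_Λ X^ε = (g)` with `ι(pⁿ · g) = ι(c) · ϖ · ι(L)` for some `n ≥ 0`,
`c ∈ Λ` — "`L_p^ε ∣ ξ(X^ε)` in `Λ ⊗ ℚ_p`", the LOWER BOUND for the signed Selmer group (the half not
given by Kobayashi's Thm. 4.1 = the tree's `Kobayashi2003.thm41_signedCharIdeal_divisibility`). By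
Lemma 9.16 (ii) (Kobayashi Thm. 7.4) this is, for EITHER sign, the printed hypothesis of Prop. 12.1 at
a supersingular `p` (module docstring). Same quantifier prefix as the two-sided
`SignedCharIdealEqPadicLFunctionNeron W p ε` of the sibling file, which implies it
(`signedCharIdealLePadicLFunctionRat_of_signedCharIdealEq`).
[cite: BurungaleSkinnerTianWan2024, statement 9.4 (b) (p. 80; label KatopLss) with Lemma 9.16 (ii) (p. 82) and the hypothesis display of Prop. 12.1 (p. 95) (shape only; nothing asserted)]
[cite: Kobayashi2003, Main Conj. (p. 2) and Thm. 7.4 (shape only)] -/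
def SignedCharIdealLePadicLFunctionRat (W : WeierstrassCurve ℚ) [W.IsElliptic]
    [W.IsGloballyMinimal] (p : ℕ) [Fact p.Prime] (ε : ℤˣ) : Prop :=
  ∀ (κ : ZpExtension ℚ p) (γ : Field.absoluteGaloisGroup ℚ),
      κ.IsCyclotomic → κ.IsTopGenerator γ → IsCyclotomicVariable p γ →
    ∀ [NeZero (W.conductorNorm ℤ)] (f : CuspForm (Gamma0 (W.conductorNorm ℤ)) 2),
      IsNewformOf W f → ∀ (ϖ : ℚ), (ϖ : ℝ) * W.realPeriodRat = plusPeriod f →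
    ∀ (L : IwasawaAlgebra p), IsSignedPAdicLFunction f p ε L →
    ∀ (D : SignedSelmerDualData W κ γ ε), Module.IsTorsion (IwasawaAlgebra p) D.X ∧
      ∃ (g c : IwasawaAlgebra p) (n : ℕ), D.charIdeal = Ideal.span {g} ∧
        iwasawaToPowerSeries p ((p : IwasawaAlgebra p) ^ n * g) =
          iwasawaToPowerSeries p c * (PowerSeries.C (ϖ : ℚ_[p]) * iwasawaToPowerSeries p L)

/-! ### The two-sided statements imply the one-sided rational halves -/

/-- The two-sided Néron-normalised cyclotomic statement (`CharIdealEqPadicLFunctionNeron`, sibling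
file: `char_Λ X = (g)`, `ι g = ϖ · L_p`) implies the one-sided rational half (`n = 0`, `c = 1`).
Between predicates; asserts nothing. [cite: BurungaleSkinnerTianWan2024, statement 9.3 (b) (p. 79) and Lemma 9.16 (i) (p. 82) (shape only)] -/
theorem charIdealLePadicLFunctionRat_of_charIdealEq {W : WeierstrassCurve ℚ} [W.IsElliptic]
    [W.IsGloballyMinimal] {p : ℕ} [Fact p.Prime] (h : CharIdealEqPadicLFunctionNeron W p) :
    CharIdealLePadicLFunctionRat W p := by
  intro κ γ hκ hγ hγ' _ f hf ϖ hϖ D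
  obtain ⟨htors, g, hg, hι⟩ := h κ γ hκ hγ hγ' f hf ϖ hϖ D
  refine ⟨htors, g, 1, 0, hg, ?_⟩
  rw [pow_zero, one_mul, map_one, one_mul, hι]

/-- The two-sided signed statement (`SignedCharIdealEqPadicLFunctionNeron`, sibling file) implies the
one-sided rational signed half (`n = 0`, `c = 1`). Between predicates; asserts nothing.
[cite: BurungaleSkinnerTianWan2024, statement 9.4 (b) (p. 80) and Lemma 9.16 (ii) (p. 82) (shape only)] -/
theorem signedCharIdealLePadicLFunctionRat_of_signedCharIdealEq {W : WeierstrassCurve ℚ}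
    [W.IsElliptic] [W.IsGloballyMinimal] {p : ℕ} [Fact p.Prime] {ε : ℤˣ}
    (h : SignedCharIdealEqPadicLFunctionNeron W p ε) : SignedCharIdealLePadicLFunctionRat W p ε := by
  intro κ γ hκ hγ hγ' _ f hf ϖ hϖ L hL D
  obtain ⟨htors, g, hg, hι⟩ := h κ γ hκ hγ hγ' f hf ϖ hϖ L hL D
  refine ⟨htors, g, 1, 0, hg, ?_⟩
  rw [pow_zero, one_mul, map_one, one_mul, hι]

/-! ### A REFEREED source of the ordinary predicate: Burungale–Castella–Skinner 2025 Thm. 1.1.2 (a) -/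

/-- Clearing denominators in `ℚ_p`: some `pⁿ · x` is a `p`-adic integer. [folklore] -/
private theorem exists_pow_mul_eq_coe (p : ℕ) [Fact p.Prime] (x : ℚ_[p]) :
    ∃ (n : ℕ) (X : ℤ_[p]), (X : ℚ_[p]) = (p : ℚ_[p]) ^ n * x := by
  by_cases hx : x = 0
  · exact ⟨0, 0, by simp [hx]⟩
  have hp : (p : ℝ) ≠ 0 := by exact_mod_cast (Fact.out : p.Prime).ne_zero
  have hn := Padic.norm_eq_zpow_neg_valuation hx
  refine ⟨(-x.valuation).toNat, ⟨(p : ℚ_[p]) ^ (-x.valuation).toNat * x, ?_⟩, rfl⟩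
  rw [norm_mul, norm_pow, Padic.norm_p, hn, inv_pow, ← zpow_natCast, ← zpow_neg, ← zpow_add₀ hp]
  have hp1 : (1 : ℝ) ≤ p := by exact_mod_cast (Fact.out : p.Prime).one_lt.le
  calc (p : ℝ) ^ (-((-x.valuation).toNat : ℤ) + -x.valuation) ≤ (p : ℝ) ^ (0 : ℤ) := by
        apply zpow_le_zpow_right₀ hp1
        omega
    _ = 1 := zpow_zero _

/-- `ι(C X) = C X` for the inclusion `ι : Λ = ℤ_p⟦T⟧ ↪ ℚ_p⟦T⟧`. [folklore] -/
private theorem iwasawaToPowerSeries_C' (p : ℕ) [Fact p.Prime] (X : ℤ_[p]) :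
    iwasawaToPowerSeries p (PowerSeries.C X) = PowerSeries.C (X : ℚ_[p]) := by
  simp [iwasawaToPowerSeries, PowerSeries.map_C]

/-- `ι(p) = C p`. [folklore] -/
private theorem iwasawaToPowerSeries_natCast' (p : ℕ) [Fact p.Prime] (m : ℕ) :
    iwasawaToPowerSeries p (m : IwasawaAlgebra p) = PowerSeries.C (m : ℚ_[p]) := by
  rw [map_natCast, map_natCast]

/-- **The tree's REFEREED fact Burungale–Castella–Skinner 2025 Thm. 1.1.2 (a)** — Mazur's main conj.
in `Λ ⊗ ℚ_p` (`char_Λ X = (g)`, `ι g = p^k · L_p(f, α)`, `k ∈ ℤ`) at a prime `p ≥ 5` of good ordinary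
reduction with `E[p]` irreducible — **supplies the ordinary one-sided rational predicate** (indeed both
halves): with `ϖ · Ω_E = Ω⁺_f` one has `ϖ ≠ 0` (`Ω⁺_f > 0`, tree theorem
`IsNewform0.plusPeriod_pos_holds`), and `pⁿ · p^k · ϖ⁻¹ ∈ ℤ_p` for `n` large gives `ι(pⁿ g) =
ι(C(pⁿ p^k ϖ⁻¹)) · ϖ · L_p`. No (ram), no (sur). [cite: BurungaleCastellaSkinner2025, Thm. 1.1.2 (a) (p. 2 of arXiv:2405.00270v2)] -/
theorem charIdealLePadicLFunctionRat_of_bcs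
    (hBCS : burungale_castella_skinner_charIdeal_eq_padicLFunction)
    (W : WeierstrassCurve ℚ) [W.IsElliptic] [W.IsGloballyMinimal] (p : ℕ) [Fact p.Prime]
    (hp : 5 ≤ p) (hgood : W.HasGoodReductionAtPrime p) (hord : ¬ (p : ℤ) ∣ W.frobeniusTrace p)
    (hirr : W.HasIrreducibleModPGaloisRep p) : CharIdealLePadicLFunctionRat W p := by
  intro κ γ hκ hγ hγ' _ f hf ϖ hϖ D
  obtain ⟨htors, g, k, hchar, hι⟩ := hBCS W p κ γ f hp hgood hord hirr hκ hγ hγ' hf D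
  -- `ϖ ≠ 0` since `Ω⁺_f > 0`
  have hpos : 0 < plusPeriod f := IsNewform0.plusPeriod_pos_holds hf.1 hf.coeffField_eq_bot
  have hϖ0 : (ϖ : ℚ_[p]) ≠ 0 := by
    have hϖ0' : ϖ ≠ 0 := by
      rintro rfl
      rw [Rat.cast_zero, zero_mul] at hϖ
      exact hpos.ne' hϖ.symm
    exact_mod_cast hϖ0'
  have hpQ : (p : ℚ_[p]) ≠ 0 := by exact_mod_cast (Fact.out : p.Prime).ne_zero
  -- clear the denominator of `p^k · ϖ⁻¹`
  obtain ⟨n, X, hX⟩ := exists_pow_mul_eq_coe p ((p : ℚ_[p]) ^ k * (ϖ : ℚ_[p])⁻¹)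
  refine ⟨htors, g, PowerSeries.C X, n, hchar, ?_⟩
  rw [map_mul, map_pow, iwasawaToPowerSeries_natCast', hι, iwasawaToPowerSeries_C', hX,
    ← mul_assoc (PowerSeries.C _) (PowerSeries.C _), ← map_mul, ← map_pow, ← mul_assoc,
    ← map_mul]
  congr 2
  field_simp

/-! ### The OPEN binders: Prop. 12.1, ordinary and supersingular branches -/

/-- **OPEN HYPOTHESIS — UNREFEREED PREPRINT (arXiv:2409.01350v2), Prop. 12.1 (p. 95), for an elliptic
curve at an ORDINARY prime: the cyclotomic criterion for the `p`-converse over `L`.** "Let `g = f_E`,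
`p ∤ 2N`, `p ∤ a_p`. Let `L` be an imaginary quadratic field satisfying (ord), (coprime) and (Heeg).
Suppose the [one-sided, rational] divisibility of statement 9.6 (b) for `h ∈ {g, g ⊗ χ_L}`. If (inj)
the localisation `H¹_f(L,V) → ∏_{w∣p} H¹_f(L_w,V)` is an injection, then `dim H¹_f(L,V) = 1 ⟹ ord_{s=1}
L(s, g_{/L}) = 1`." Transcribed (module docstring): `W` globally minimal, `p ≠ 2`, good at `p`,
`p ∤ a_p`; `K = L` imaginary quadratic, `p` split, `(d_K, N_E) = 1`, Heegner hypothesis for `N_E`;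
`W'` a globally minimal model of `E^{(d_K)}`; the two rational one-sided statements
`CharIdealLePadicLFunctionRat W p`, `… W' p`; (inj) as finiteness of the joint strict Selmer group at
the primes above `p`; conclusion `corank_{ℤ_p} Sel_{p^∞}(E/K) = 1 → ord_{s=1} L(E/K, s) = 1`
(`analyticRankEK`). NEVER cite this `Prop` as a theorem. [claim: BurungaleSkinnerTianWan2024, status: under-review]
[cite: BurungaleSkinnerTianWan2024, Prop. 12.1 (p. 95; label p-converse-prop, tex l.8089–8110), ordinary branch (ANNOUNCED, OPEN binder)] -/
def prop121_pConverse_of_charIdealLe_ordinary_OPEN : Prop :=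
  ∀ (W W' : WeierstrassCurve ℚ) [W.IsElliptic] [W.IsGloballyMinimal] [W'.IsElliptic]
    [W'.IsGloballyMinimal] (K : Type u) [Field K] [NumberField K] (p : ℕ) [Fact p.Prime]
    (C : VariableChange ℚ),
    -- `p ∤ 2N` ordinary
    p ≠ 2 → W.HasGoodReductionAtPrime p → ¬ (p : ℤ) ∣ W.frobeniusTrace p →
    -- `L = K`: imaginary quadratic, (ord), (coprime), (Heeg)
    IsImaginaryQuadratic K →
    ((Ideal.span {(p : ℤ)}).primesOver (𝓞 K)).ncard = 2 →
    IsCoprime (NumberField.discr K) (W.conductorNorm ℤ) →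
    SatisfiesHeegnerHypothesis (W.conductorNorm ℤ) K →
    -- `g ⊗ χ_L`: a globally minimal model `W'` of the twist by `d_K`
    C • W' = W.quadraticTwist (NumberField.discr K : ℚ) →
    -- the one-sided rational divisibility of statement 9.6 (b) ≡ 9.3 (b) for `g` and `g ⊗ χ_L`
    CharIdealLePadicLFunctionRat W p → CharIdealLePadicLFunctionRat W' p →
    -- (inj): the joint strict Selmer group at the primes above `p` is finite
    Finite ↥((W.baseChange K).selmerGroupPInfty p ⊓
      ⨅ (w : HeightOneSpectrum (𝓞 K)) (_ : ((p : ℕ) : 𝓞 K) ∈ w.asIdeal),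
        selmerLocalKerPrimaryTorsion (W.baseChange K) (w.adicCompletion K) p) →
    -- `dim H¹_f(L, V) = 1 ⟹ ord_{s=1} L(s, E/L) = 1`
    ((W.baseChange K).selmerCorank p = 1 → analyticRankEK W K = 1)

/-- **OPEN HYPOTHESIS — UNREFEREED PREPRINT (arXiv:2409.01350v2), Prop. 12.1 (p. 95), for an elliptic
curve at a SUPERSINGULAR prime `a_p = 0`: the cyclotomic criterion for the `p`-converse over `L`.**
Same as the ordinary binder with "`a_p(g) = 0`" and the one-sided rational SIGNED statements 9.6 (b) ≡
9.4 (b) (Lemma 9.16 (ii)) for `g` and `g ⊗ χ_L`, asked for BOTH signs (flag `BSTW-121-ss-bothsigns`,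
WEAKER than print). Print: "We present the ordinary case" (proof, p. 95) and Remark 12.2 (p. 96).
NEVER cite this `Prop` as a theorem. [claim: BurungaleSkinnerTianWan2024, status: under-review]
[cite: BurungaleSkinnerTianWan2024, Prop. 12.1 (p. 95; label p-converse-prop, tex l.8089–8110), supersingular branch, with Remark 12.2 (p. 96) (ANNOUNCED, OPEN binder)] -/
def prop121_pConverse_of_signedCharIdealLe_supersingular_OPEN : Prop :=
  ∀ (W W' : WeierstrassCurve ℚ) [W.IsElliptic] [W.IsGloballyMinimal] [W'.IsElliptic]
    [W'.IsGloballyMinimal] (K : Type u) [Field K] [NumberField K] (p : ℕ) [Fact p.Prime]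
    (C : VariableChange ℚ),
    -- `p ∤ 2N` supersingular, `a_p = 0`
    p ≠ 2 → W.HasGoodReductionAtPrime p → W.frobeniusTrace p = 0 →
    -- `L = K`: imaginary quadratic, (ord), (coprime), (Heeg)
    IsImaginaryQuadratic K →
    ((Ideal.span {(p : ℤ)}).primesOver (𝓞 K)).ncard = 2 →
    IsCoprime (NumberField.discr K) (W.conductorNorm ℤ) →
    SatisfiesHeegnerHypothesis (W.conductorNorm ℤ) K →
    -- `g ⊗ χ_L`: a globally minimal model `W'` of the twist by `d_K`
    C • W' = W.quadraticTwist (NumberField.discr K : ℚ) →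
    -- the one-sided rational signed divisibility 9.6 (b) ≡ 9.4 (b), both signs, for `g`, `g ⊗ χ_L`
    (∀ ε : ℤˣ, SignedCharIdealLePadicLFunctionRat W p ε) →
    (∀ ε : ℤˣ, SignedCharIdealLePadicLFunctionRat W' p ε) →
    -- (inj): the joint strict Selmer group at the primes above `p` is finite
    Finite ↥((W.baseChange K).selmerGroupPInfty p ⊓
      ⨅ (w : HeightOneSpectrum (𝓞 K)) (_ : ((p : ℕ) : 𝓞 K) ∈ w.asIdeal),
        selmerLocalKerPrimaryTorsion (W.baseChange K) (w.adicCompletion K) p) →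
    -- `dim H¹_f(L, V) = 1 ⟹ ord_{s=1} L(s, E/L) = 1`
    ((W.baseChange K).selmerCorank p = 1 → analyticRankEK W K = 1)

/-! ### Bookkeeping between the binders and the tree's published / typed shapes -/

/-- **Granted the ordinary Prop. 12.1 binder, the two-sided cyclotomic statements for `E` and
`E ⊗ χ_L` (the hypotheses of gen 2's Prop. 11.11 / Prop. 12.10 binders) already give the criterion** —
the one-sided halves follow (`charIdealLePadicLFunctionRat_of_charIdealEq`). Between binders; asserts
nothing. [claim: BurungaleSkinnerTianWan2024, status: under-review]
[cite: BurungaleSkinnerTianWan2024, Prop. 12.1 (p. 95; OPEN binder) with Lemma 9.16 (i) (p. 82)] -/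
theorem analyticRankEK_eq_one_of_prop121_ordinary_OPEN_of_charIdealEq
    (h : prop121_pConverse_of_charIdealLe_ordinary_OPEN.{u})
    (W W' : WeierstrassCurve ℚ) [W.IsElliptic] [W.IsGloballyMinimal] [W'.IsElliptic]
    [W'.IsGloballyMinimal] (K : Type u) [Field K] [NumberField K] (p : ℕ) [Fact p.Prime]
    {C : VariableChange ℚ} (hp2 : p ≠ 2) (hgood : W.HasGoodReductionAtPrime p)
    (hord : ¬ (p : ℤ) ∣ W.frobeniusTrace p) (hK : IsImaginaryQuadratic K)
    (hsplit : ((Ideal.span {(p : ℤ)}).primesOver (𝓞 K)).ncard = 2)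
    (hcop : IsCoprime (NumberField.discr K) (W.conductorNorm ℤ))
    (hH : SatisfiesHeegnerHypothesis (W.conductorNorm ℤ) K)
    (hC : C • W' = W.quadraticTwist (NumberField.discr K : ℚ))
    (hMC : CharIdealEqPadicLFunctionNeron W p) (hMC' : CharIdealEqPadicLFunctionNeron W' p)
    (hinj : Finite ↥((W.baseChange K).selmerGroupPInfty p ⊓
      ⨅ (w : HeightOneSpectrum (𝓞 K)) (_ : ((p : ℕ) : 𝓞 K) ∈ w.asIdeal),
        selmerLocalKerPrimaryTorsion (W.baseChange K) (w.adicCompletion K) p))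
    (hcork : (W.baseChange K).selmerCorank p = 1) : analyticRankEK W K = 1 :=
  h W W' K p C hp2 hgood hord hK hsplit hcop hH hC (charIdealLePadicLFunctionRat_of_charIdealEq hMC)
    (charIdealLePadicLFunctionRat_of_charIdealEq hMC') hinj hcork

/-- **Granted the ordinary Prop. 12.1 binder (PREPRINT) and the tree's REFEREED Burungale–Castella–
Skinner 2025 Thm. 1.1.2 (a): a `p`-converse over `L` at a prime `p ≥ 5` of good ordinary reduction
for `E` and `E^{(d_L)}` under (irr_ℚ) for both, and (inj) — no (ram), no (sur), no Heegner-point main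
conj.** For `W`, `W'` globally minimal models of `E`, `E^{(d_K)}` (`K` imaginary quadratic with (ord),
(coprime), (Heeg)), `p ≥ 5` good ordinary for both with `E[p]`, `E^{(d_K)}[p]` irreducible (the
reduction and irreducibility hypotheses on the twist are automatic for `p ∤ d_K`, kept as binders):
`corank_{ℤ_p} Sel_{p^∞}(E/K) = 1 ⟹ ord_{s=1} L(E/K, s) = 1`. The deep input is the OPEN binder; this
theorem only composes it with `charIdealLePadicLFunctionRat_of_bcs`. [claim: BurungaleSkinnerTianWan2024, status: under-review]
[cite: BurungaleSkinnerTianWan2024, Prop. 12.1 (p. 95; OPEN binder)]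
[cite: BurungaleCastellaSkinner2025, Thm. 1.1.2 (a) (p. 2 of arXiv:2405.00270v2)] -/
theorem analyticRankEK_eq_one_of_prop121_ordinary_OPEN_of_bcs
    (h : prop121_pConverse_of_charIdealLe_ordinary_OPEN.{u})
    (hBCS : burungale_castella_skinner_charIdeal_eq_padicLFunction)
    (W W' : WeierstrassCurve ℚ) [W.IsElliptic] [W.IsGloballyMinimal] [W'.IsElliptic]
    [W'.IsGloballyMinimal] (K : Type u) [Field K] [NumberField K] (p : ℕ) [Fact p.Prime]
    {C : VariableChange ℚ} (hp : 5 ≤ p) (hgood : W.HasGoodReductionAtPrime p)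
    (hord : ¬ (p : ℤ) ∣ W.frobeniusTrace p) (hirr : W.HasIrreducibleModPGaloisRep p)
    (hgood' : W'.HasGoodReductionAtPrime p) (hord' : ¬ (p : ℤ) ∣ W'.frobeniusTrace p)
    (hirr' : W'.HasIrreducibleModPGaloisRep p) (hK : IsImaginaryQuadratic K)
    (hsplit : ((Ideal.span {(p : ℤ)}).primesOver (𝓞 K)).ncard = 2)
    (hcop : IsCoprime (NumberField.discr K) (W.conductorNorm ℤ))
    (hH : SatisfiesHeegnerHypothesis (W.conductorNorm ℤ) K)
    (hC : C • W' = W.quadraticTwist (NumberField.discr K : ℚ))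
    (hinj : Finite ↥((W.baseChange K).selmerGroupPInfty p ⊓
      ⨅ (w : HeightOneSpectrum (𝓞 K)) (_ : ((p : ℕ) : 𝓞 K) ∈ w.asIdeal),
        selmerLocalKerPrimaryTorsion (W.baseChange K) (w.adicCompletion K) p))
    (hcork : (W.baseChange K).selmerCorank p = 1) : analyticRankEK W K = 1 := by
  have hp2 : p ≠ 2 := by omega
  exact h W W' K p C hp2 hgood hord hK hsplit hcop hH hC
    (charIdealLePadicLFunctionRat_of_bcs hBCS W p hp hgood hord hirr)
    (charIdealLePadicLFunctionRat_of_bcs hBCS W' p hp hgood' hord' hirr') hinj hcork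

/-- **Granted the supersingular Prop. 12.1 binder, the two-sided signed statements for `E` and
`E ⊗ χ_L`, both signs (the hypotheses of gen 3's Prop. 11.11 supersingular binder; supplied on the
semistable locus by gen 3's Thm. 10.1 binder via `signedCharIdealEq_of_thm101_OPEN_of_goodSS`),
already give the criterion.** Between binders; asserts nothing. [claim: BurungaleSkinnerTianWan2024, status: under-review]
[cite: BurungaleSkinnerTianWan2024, Prop. 12.1 (p. 95; OPEN binder) with Lemma 9.16 (ii) (p. 82)] -/
theorem analyticRankEK_eq_one_of_prop121_supersingular_OPEN_of_signedCharIdealEq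
    (h : prop121_pConverse_of_signedCharIdealLe_supersingular_OPEN.{u})
    (W W' : WeierstrassCurve ℚ) [W.IsElliptic] [W.IsGloballyMinimal] [W'.IsElliptic]
    [W'.IsGloballyMinimal] (K : Type u) [Field K] [NumberField K] (p : ℕ) [Fact p.Prime]
    {C : VariableChange ℚ} (hp2 : p ≠ 2) (hgood : W.HasGoodReductionAtPrime p)
    (hap : W.frobeniusTrace p = 0) (hK : IsImaginaryQuadratic K)
    (hsplit : ((Ideal.span {(p : ℤ)}).primesOver (𝓞 K)).ncard = 2)
    (hcop : IsCoprime (NumberField.discr K) (W.conductorNorm ℤ))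
    (hH : SatisfiesHeegnerHypothesis (W.conductorNorm ℤ) K)
    (hC : C • W' = W.quadraticTwist (NumberField.discr K : ℚ))
    (hMC : ∀ ε : ℤˣ, SignedCharIdealEqPadicLFunctionNeron W p ε)
    (hMC' : ∀ ε : ℤˣ, SignedCharIdealEqPadicLFunctionNeron W' p ε)
    (hinj : Finite ↥((W.baseChange K).selmerGroupPInfty p ⊓
      ⨅ (w : HeightOneSpectrum (𝓞 K)) (_ : ((p : ℕ) : 𝓞 K) ∈ w.asIdeal),
        selmerLocalKerPrimaryTorsion (W.baseChange K) (w.adicCompletion K) p))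
    (hcork : (W.baseChange K).selmerCorank p = 1) : analyticRankEK W K = 1 :=
  h W W' K p C hp2 hgood hap hK hsplit hcop hH hC
    (fun ε ↦ signedCharIdealLePadicLFunctionRat_of_signedCharIdealEq (hMC ε))
    (fun ε ↦ signedCharIdealLePadicLFunctionRat_of_signedCharIdealEq (hMC' ε)) hinj hcork

end Literature.NumberTheory.EllipticCurves.BurungaleSkinnerTianWan2024

end
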